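import Mathlib
import HarnessLib
import HarnessLib.Audit
import Summits.ABC.ABC.Theses.TwistAmplification
import Summits.ABC.ABC.Theorems.TwistAmplificationMazurKaneLawShapeLevelLift
import Summits.ABC.ABC.Theorems.TwistAmplificationMazurKaneLawSliceClassBound
import Summits.ABC.ABC.Theorems.TwistAmplificationMazurKaneLawSliceReduction
import Summits.ABC.ABC.Theorems.TwistAmplificationMazurKaneLawSlices
import Summits.ABC.ABC.Theorems.TwistAmplificationMazurKaneLawLeverPell
import Summits.ABC.ABC.Theorems.TwistAmplificationMazurKaneLawLeverReach
import Summits.ABC.ABC.Theorems.TwistAmplificationMazurKaneLawSliceClassBoundHigh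
import Literature.NumberTheory.DiophantineGeometry.AbcShapeReductionCount
import Literature.NumberTheory.DiophantineGeometry.AbcExceptionalSetBoundsProofs

/-!
# Line `peyre-level-torsor-v22` — crux `TwistAmplification.MazurKaneLaw` (stmt-ABC-2757) — skeleton v3

Lead prover-line-stmt-ABC-2757-0, 2026-08-16 (v1 = crux-plan skeleton of planner-cruxplan-stmt-ABC-2757-peyre-level-torsor-v-0;
v2 = lead's reshape 1, `HighSlicesTransfer` split into `SliceClassBound` + `SliceReduction`; v3 = this file, after wave 1 and
reshape 2).

THE CRUX. `MazurKaneLaw`: for every `1 < s < 2`, `ε > 0`: `#{abc triples, c ≤ N, rad(abc) ≤ c^s} ≤ C N^{s-1+ε}`.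

THE LINE AFTER WAVE 1. Everything the line can prove today is LANDED under `Summits/ABC/ABC/Theorems/` (namespace
`Summit.ABC.ABC.Theorems`, all `--supports stmt-ABC-2757`):
* `ShapeLevelLift` (p73647): the `d = 2` lever `LevelTorsorBound` lifts to the shape-level bound `ShapeLevelBound` in every
  dimension (fibring over the level coordinates); with the drefuter's remark (`ShapeLevelBoundIffLevelTorsorBound.lean`) the two
  are EQUIVALENT;
* `SliceClassBound` (p73765) + `SliceReduction` (p73080): per-class exponent bookkeeping + the slice version of the BBLT
  Prop. 2.1 reduction, i.e. `ShapeLevelBound ⟹ LeverSliceBound` (every radical slice `s' ∈ (1,2)` is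
  `≪ N^{max(s'-1,(3-s')/2)+ε}`);
* `SliceAssembly` (p74525, file `…Slices`): the kernel-checked glue `SliceLawHigh → SliceLawLow → HitBound → MazurKaneLaw`
  (abstract slice assembly, floor at the hits);
* `LeverReach` + `MazurKaneLaw.sliceLawHigh_of_levelTorsorBound` (file `…LeverReach`): `LevelTorsorBound ⟹ SliceLawHigh`, and the
  honest reach of the lever ALONE: `LevelTorsorBound ⟹ MazurKaneLaw on [13/7, 2)` (floor `9/7` by the proved trivial bound);
* `SliceClassBoundHigh` (p76737) (+ the Theorems file `…HighSliceLever`, `HighSliceLever`, proposed): the RESTRICTED, Hooley-free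
  lever `ShapeLevelBoundOnHighSlices` (torsor bound asked only on high-slice classes) `⟹ SliceLawHigh`
  (`sliceLawHigh_of_shapeLevelBoundOnHighSlices` below, proved here from the landed pieces);
* `LeverPellBox` (p74856, file `…LeverPell`): a HARDNESS CERTIFICATE — `LevelTorsorBound` specialised to `f = (1,1,1)`,
  `X = (D,U)`, `Y = (1,1)`, `Z = (1,T)` bounds the Pell box count `#{t² = du² + 1}` by `K T^{2ε}(1 + DU/T) ≍ √D` uniformly in
  `U`, i.e. it contains the upper-bound half of HOOLEY'S CONJECTURE (1984) on fundamental units for every exponent `α` (proved only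
  for `α ≤ 1/2`; best bound `x^{α/3+7/12+ε}`, Fouvry–Jouve 2013) — in a corner (abc exponent `≤ 3/2`) irrelevant to the range
  `[5/3, 2)` the lever serves.

RESHAPE 2 (this file). Because the lever as registered is Hooley-hard for reasons foreign to the crux, the registered high-range
stub is now the SLICE LAW ITSELF, `SliceLawHigh` (the Mazur–Kane density on the radical slices `[5/3, 2)`, Hooley-free: Pell classes
never reach these slices), and the composition is the pure RANGE SPLIT `MazurKaneLaw_of : SliceLawHigh → SliceLawLow → HitBound →
MazurKaneLaw` (= landed `SliceAssembly`). The torsor lever survives as a kernel-checked SUFFICIENT ROUTE to the first stub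
(`sliceLawHigh_of_levelTorsorBound`), with its reach (`lawAt_high_of_levelTorsorBound`) and its price (`pellBox_of_levelTorsorBound`)
recorded next to it; a future lever for `SliceLawHigh` should be a torsor/level-of-distribution bound RESTRICTED to high-slice boxes
(radical lower bound `X₀X₁Y₀Y₁Z₀Z₁·rad(levels) ≥ c^{5/3-η}`, small cofactors — cf. drefute report A.4), which is all the landed chain
consumes. All three remaining stubs are crux-sized (they partition the crux by radical range); the lead hands them back for
promotion with the glue landed.

Disproof.lean (cdisprove; not mounted in this jail, read through its evidence notes) is honoured as in v1/v2: every stub keeps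
`+ε` (`not_lawAt_zero`, `abcExponentCount_not_bigO`), coprimality (`IsABCTriple`), `1 < s` (`SliceLawLow` only for `1 < s'`;
the `s' ≤ 1` mass is `HitBound`, necessary by `abcHitCount_le_of_mazurKaneLaw`). `ledger negatives --problem ABC`: no overlap.
-/

namespace Summit.ABC.ABC.Cruxes.MazurKaneLaw.PeyreLevelTorsorV22

open scoped BigOperators
open Literature.NumberTheory.DiophantineGeometry
open Literature.NumberTheory.DiophantineGeometry.AbcShapes

/-! ## The three registered statements: the radical ranges of the crux -/

/-- **Stub H · SliceLawHigh** (registered; OPEN; the line's target range) — the Mazur–Kane law on the radical SLICES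
`rad(abc) ∈ (c^{s'-η}, c^{s'}]`, `s' ∈ [5/3, 2)`, with a window `η = η(ε) > 0` uniform in `s'`. It is the crux restricted to
the high slices (implied by the crux: slice ⊆ cumulative set), so not cheaper to refute than the crux; SUFFICIENT for it:
the torsor lever `LevelTorsorBound` (`sliceLawHigh_of_levelTorsorBound`, kernel-checked from the landed chain) — which however
is Hooley-hard as stated (`pellBox_of_levelTorsorBound`); the right lever is a level-of-distribution statement for the points of
`V₂² : x₀y₀² + x₁y₁² + x₂y₂² = 0` restricted to HIGH-SLICE boxes (the wall family `a,b,c = u·x²·w³`, `u ≍ x ≍ N^{(1-δ)/3}`,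
`w ≍ N^{δ/3}`, is the worst case; full saving `N^{-δ}` over Kane's "+1 per fibre" is forced, TRIAGE r1-2). WHY IT MIGHT FAIL:
only together with the crux (all explicit families sit ON `N^{s'-1}(log N)^{O(1)}`, Disproof §1–2; Kane Thm 1 lower bound).
[arXiv:1104.2635 Conj. 1, §4; arXiv:1308.0033 Lemmas 1–4; arXiv:2410.12234 Prop. 2.1] -/
def SliceLawHigh : Prop :=
  ∀ ε : ℝ, 0 < ε → ∃ η : ℝ, 0 < η ∧ ∀ s : ℝ, 5 / 3 ≤ s → s < 2 → ∃ C : ℝ, ∀ N : ℕ, 2 ≤ N →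
    (Set.ncard {t : ℕ × ℕ × ℕ | IsABCTriple t.1 t.2.1 t.2.2 ∧ t.2.2 ≤ N ∧
        (t.2.2 : ℝ) ^ (s - η) < ((rad t.1 t.2.1 t.2.2 : ℕ) : ℝ) ∧
        ((rad t.1 t.2.1 t.2.2 : ℕ) : ℝ) ≤ (t.2.2 : ℝ) ^ s} : ℝ) ≤ C * (N : ℝ) ^ (s - 1 + ε)

/-- **Stub L · SliceLawLow** (registered; FOREIGN to the torsor lever; open; = the Mazur–Kane density on the low slices
`s' ∈ (1, 5/3)`, where the first enemy is the twisted Fermat-cubic level lattice `u₀y₀³ + u₁y₁³ = u₂y₂³`, `Y³ > U²`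
— candidate levers: crux ideas `aligned-power-curve-rigidity`, `critical-kloosterman-powerful-moduli`; RECOMMENDED:
promote to a crux of the route = the range split `MKL(1,5/3]` asked for by all three triagers). Together with
`HitBound` it is equivalent to the crux restricted to `s ≤ 5/3`; it is stated as a slice law (window `η(ε)` uniform
in `s'`) because that is the form the assembly consumes and the form any box/shape method produces. WHY IT MIGHT
FAIL: it is most of Mazur's question; near `s' → 1⁺` it bounds near-hits by `N^{s'-1+ε}`; a positive-power family
of near-hits (none known; Dahmen-type constructions give `exp((log N)^{1/2})`) would refute it. [arXiv:1104.2635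
Conj. 1; Mazur, Notices AMS 47 (2000) p.198; arXiv:2410.12234 Thm 1.2] -/
def SliceLawLow : Prop :=
  ∀ ε : ℝ, 0 < ε → ∃ η : ℝ, 0 < η ∧ ∀ s : ℝ, 1 < s → s < 5 / 3 → ∃ C : ℝ, ∀ N : ℕ, 2 ≤ N →
    (Set.ncard {t : ℕ × ℕ × ℕ | IsABCTriple t.1 t.2.1 t.2.2 ∧ t.2.2 ≤ N ∧
        (t.2.2 : ℝ) ^ (s - η) < ((rad t.1 t.2.1 t.2.2 : ℕ) : ℝ) ∧
        ((rad t.1 t.2.1 t.2.2 : ℕ) : ℝ) ≤ (t.2.2 : ℝ) ^ s} : ℝ) ≤ C * (N : ℝ) ^ (s - 1 + ε)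

/-- **Stub E · HitBound** (registered; FOREIGN to the torsor lever; open; the `s → 1⁺` content of the crux): abc hits
(`rad(abc) ≤ c`, non-strict) up to `N` are `≪_ε N^ε`. NECESSARY: Disproof §3 `abcHitCount_le_of_mazurKaneLaw`
(crux ⇒ hits `≪ X^δ ∀ δ`). Record: `N^{33/50}` / `N^{56/85+ε}` (tree `bernertEtAl2024_thm_1_2`, `Li2025`), in-tree
proved `ABCHitCountUpperBound_holds` (`N^{2/3+ε}`); lower bound `exp((log N)^{1/2-ε})` (Dahmen 2008, tree
`abcHitCount_lower_bound`) is consistent. RECOMMENDED: promote to a crux of the route (it is shared by every line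
on this crux). WHY IT MIGHT FAIL: an `N^κ` family of hits would refute it (and be a major theorem); none known.
[arXiv:2410.12234 Thm 1.2; arXiv:2507.02885 Thm 1.3; Dahmen2008 Thm 1] -/
def HitBound : Prop :=
  ∀ ε : ℝ, 0 < ε → ∃ C : ℝ, ∀ N : ℕ, 2 ≤ N →
    (Set.ncard {t : ℕ × ℕ × ℕ | IsABCTriple t.1 t.2.1 t.2.2 ∧ t.2.2 ≤ N ∧
        rad t.1 t.2.1 t.2.2 ≤ t.2.2} : ℝ) ≤ C * (N : ℝ) ^ ε

/-! ## The sufficient route to `SliceLawHigh`: the torsor lever (documentation `Prop`s; NOT registered) -/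

/-- **LevelTorsorBound** (the torsor LEVER of v1/v2; NOT registered in v3 — see the module docstring; kept as the documented sufficient route to `SliceLawHigh`).
Le Boudec's torsor count for `V₂² ⊂ ℙ²×ℙ²` in its level (= coefficient) aspect, MAX-form, positive dyadic version,
written with the tree's `shapeCount` at `d = 2` (coordinate `0` = Le Boudec's `u`, coordinate `1` = his `v`,
`(f₁,f₂,f₃)` = his coefficient vector `f`): the number of `(x₀,x₁,y₀,y₁,z₀,z₁)` in dyadic boxes with
`f₁x₀x₁² + f₂y₀y₁² = f₃z₀z₁²` and `gcd(f₁x₀x₁, f₂y₀y₁, f₃z₀z₁) = 1` is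
`≤ K_ε (f₃Z₀Z₁²)^ε (1 + X₀X₁Y₀Y₁Z₀Z₁/(f₃Z₀Z₁²))`, i.e. `N^ε × (1 + volume heuristic)`; the z-term `f₃Z₀Z₁²` is the
largest of the three term sizes automatically (`x-term + y-term = z-term`). KNOWN: Heath-Brown's lattice bound
(Le Boudec Lemma 1, max-form; tree `card_box_filter_coprime_congr_le`) gives this with `+ Z₀… ` replaced by
`+ X₁Y₁Z₁` (one "+1" per square fibre), Browning's conic bound + solubility density (Lemmas 2–3) give it with
`+ X₀Y₀Z₀·M_ε` (one "+1" per conic fibre); the stub is exactly "the +1 masses also see the level", Kane's own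
diagnosis (arXiv:1104.2635 §4) made quantitative, and must be a FULL saving (TRIAGE-r1-2: `η(δ) ≥ δ` on the wall
`u ≍ x ≍ N^{(1-δ)/3}`, `w ≍ N^{δ/3}`; Kane/Browning give `N`, the stub gives `N^{1-δ}`). WHY MAX-FORM (planner's
sharpening beyond the card's geometric-mean form `(ΠU)^{2/3}(ΠV)^{1/3}/F^{1/3}`): abc boxes are lopsided in the
`a`-coordinate (`a ~ N^α`, `α < 1`), where the GM form overshoots the law by `N^{(1-α)/3}` while the max form is
the law on the nose; GM = max on balanced boxes, so the card's and the panel's numerics (kit j005777, j006877,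
j006919, j006931; local torsor.py / partA) all test this stub where they ran. Two proof routes (one layer below,
lead's choice): (P1) lattice side — `#{(x₁,y₁,z₁) : Λ = (fᵢ·□ᵢ²)^⊥ has a primitive point in the u-box} ≪ N^ε(1+main)`;
(P2) conic side — sub-Holzer density `θ¹` for the conics `(fᵢxᵢ⁰)` averaged over the u-box, ring-class version
(crux idea `heegner-cusp-subholzer`, `SubHolzerDensityOne`; its provable half `SubHolzerDensityHalf` gives only
`N^{1-δ/2}` on the wall and closes nothing). STATUS (v3): (a) `ShapeLevelBound ↔ LevelTorsorBound` (drefute A.4 +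
landed `ShapeLevelLift`), so v1's fallback "register `ShapeLevelBound`" was vacuous; (b) the statement CONTAINS the Pell box
count (`pellBox_of_levelTorsorBound`: upper half of Hooley's conjecture, every `α`) — open since 1984 and foreign to the
slices `[5/3,2)`; (c) neither P1 nor P2 is within published technique at this uniformity (lead's recon: no sub-Holzer
`θ¹` density, no `λ₁` statistics for thin algebraic lattice families; the P1 Fourier coefficients are the
"inverse squares modulo squares" sums of Fouvry/Bourgain/Xi). The honest weaker sufficient forms are the small-cofactor /
high-slice-box restrictions (drefute A.4; module docstring), which is all `SliceClassBound` consumes.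
[arXiv:1308.0033 Lemmas 1–4; arXiv:1104.2635 Props 5, 6, 9, §4; doi:10.1093/imrn/rnu255; Browning MR2250046, MR2559866;
Hooley, J. reine angew. Math. 353 (1984); Fouvry, J. reine angew. Math. 717 (2016)] -/
def LevelTorsorBound : Prop :=
  ∀ ε : ℝ, 0 < ε → ∃ K : ℝ, ∀ (f₁ f₂ f₃ : ℕ) (X Y Z : Fin 2 → ℕ), 0 < f₁ → 0 < f₂ → 0 < f₃ →
    (∀ i, 0 < X i) → (∀ i, 0 < Y i) → (∀ i, 0 < Z i) →
      (shapeCount f₁ f₂ f₃ X Y Z : ℝ) ≤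
        K * ((f₃ : ℝ) * ((shapeVal Z : ℕ) : ℝ)) ^ ε *
          (1 + ((X 0 : ℝ) * X 1 * Y 0 * Y 1 * Z 0 * Z 1) / ((f₃ : ℝ) * ((shapeVal Z : ℕ) : ℝ)))

/-- **ShapeLevelBound** (the lever in the tree's shape language; equivalent to `LevelTorsorBound` — conclusion of the
landed `ShapeLevelLift`, hypothesis of the landed `SliceClassBound`). For shape data of dimension `d ≥ 2`:
`B_d(c; X, Y, Z) ≤ K (c₃ shapeVal Z)^ε (∏_{i≥2} XᵢYᵢZᵢ + ∏ᵢ XᵢYᵢZᵢ / (c₃ shapeVal Z))`. Compare the PROVED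
`shapeCount_succ_le` (Bernert Prop. 2 = Kane): `B_d ≤ 2 ∏_{i≥1} XᵢYᵢZᵢ + 112 ∏ᵢ XᵢYᵢZᵢ/(c₃ shapeVal Z)` — the
lever lowers the "+1" term from `∏_{i≥1}` (one per (square, level) fibre) to `∏_{i≥2}` (one per level fibre).
On Kane's enemy `a = u x² w³` (`P₀ = U³, P₁ = X³, P₂ = W³`, `N = UX²W³`) this is `N^ε(W³ + law)` vs Kane's
`X³W³ + law = N + law`: the missing factor is recovered on the nose. [arXiv:2506.13364 Prop. 2; arXiv:2410.12234 §2] -/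
def ShapeLevelBound : Prop :=
  ∀ ε : ℝ, 0 < ε → ∀ d : ℕ, 2 ≤ d → ∃ K : ℝ, ∀ (c₁ c₂ c₃ : ℕ) (X Y Z : Fin d → ℕ),
    0 < c₁ → 0 < c₂ → 0 < c₃ → (∀ i, 0 < X i) → (∀ i, 0 < Y i) → (∀ i, 0 < Z i) →
      (shapeCount c₁ c₂ c₃ X Y Z : ℝ) ≤
        K * ((c₃ : ℝ) * ((shapeVal Z : ℕ) : ℝ)) ^ ε *
          ((∏ i ∈ Finset.univ.filter (fun i : Fin d => 2 ≤ (i : ℕ)), ((X i : ℝ) * Y i * Z i)) +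
            (∏ i, ((X i : ℝ) * Y i * Z i)) / ((c₃ : ℝ) * ((shapeVal Z : ℕ) : ℝ)))

/-- **LeverSliceBound** — what the lever says about EVERY radical slice `s' ∈ (1, 2)` (conclusion of the landed
chain, `leverSliceBound_of_levelTorsorBound`; not a stub): `#{c ≤ N, c^{s'-η} < rad(abc) ≤ c^{s'}} ≪ N^{max(s'-1, (3-s')/2)+ε}` with a
window `η(ε)` uniform in `s'`. For `s' ≥ 5/3` the max is `s' - 1` (the law: `SliceLawHigh`); below `5/3` it is the
"+1 per level fibre" exponent `(3-s')/2 ∈ (2/3, 1)`, still a power saving under Kane's plateau `1`. -/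
def LeverSliceBound : Prop :=
  ∀ ε : ℝ, 0 < ε → ∃ η : ℝ, 0 < η ∧ ∀ s : ℝ, 1 < s → s < 2 → ∃ C : ℝ, ∀ N : ℕ, 2 ≤ N →
    (Set.ncard {t : ℕ × ℕ × ℕ | IsABCTriple t.1 t.2.1 t.2.2 ∧ t.2.2 ≤ N ∧
        (t.2.2 : ℝ) ^ (s - η) < ((rad t.1 t.2.1 t.2.2 : ℕ) : ℝ) ∧
        ((rad t.1 t.2.1 t.2.2 : ℕ) : ℝ) ≤ (t.2.2 : ℝ) ^ s} : ℝ) ≤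
      C * (N : ℝ) ^ (max (s - 1) ((3 - s) / 2) + ε)

/-! ## Registered stubs `Stub.<Name>` (`sorry` lives only here; signatures verbatim, let-free, fully qualified) -/

namespace Stub

/-- Stub H, registered form (statement verbatim = def `SliceLawHigh`). -/
theorem SliceLawHigh : ∀ ε : ℝ, 0 < ε → ∃ η : ℝ, 0 < η ∧ ∀ s : ℝ, 5 / 3 ≤ s → s < 2 → ∃ C : ℝ, ∀ N : ℕ, 2 ≤ N → (Set.ncard {t : ℕ × ℕ × ℕ | Literature.NumberTheory.DiophantineGeometry.IsABCTriple t.1 t.2.1 t.2.2 ∧ t.2.2 ≤ N ∧ (t.2.2 : ℝ) ^ (s - η) < ((Literature.NumberTheory.DiophantineGeometry.rad t.1 t.2.1 t.2.2 : ℕ) : ℝ) ∧ ((Literature.NumberTheory.DiophantineGeometry.rad t.1 t.2.1 t.2.2 : ℕ) : ℝ) ≤ (t.2.2 : ℝ) ^ s} : ℝ) ≤ C * (N : ℝ) ^ (s - 1 + ε) := by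
  sorry

/-- Stub L, registered form (statement verbatim = def `SliceLawLow`). -/
theorem SliceLawLow : ∀ ε : ℝ, 0 < ε → ∃ η : ℝ, 0 < η ∧ ∀ s : ℝ, 1 < s → s < 5 / 3 → ∃ C : ℝ, ∀ N : ℕ, 2 ≤ N → (Set.ncard {t : ℕ × ℕ × ℕ | Literature.NumberTheory.DiophantineGeometry.IsABCTriple t.1 t.2.1 t.2.2 ∧ t.2.2 ≤ N ∧ (t.2.2 : ℝ) ^ (s - η) < ((Literature.NumberTheory.DiophantineGeometry.rad t.1 t.2.1 t.2.2 : ℕ) : ℝ) ∧ ((Literature.NumberTheory.DiophantineGeometry.rad t.1 t.2.1 t.2.2 : ℕ) : ℝ) ≤ (t.2.2 : ℝ) ^ s} : ℝ) ≤ C * (N : ℝ) ^ (s - 1 + ε) := by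
  sorry

/-- Stub E, registered form (statement verbatim = def `HitBound`). -/
theorem HitBound : ∀ ε : ℝ, 0 < ε → ∃ C : ℝ, ∀ N : ℕ, 2 ≤ N → (Set.ncard {t : ℕ × ℕ × ℕ | Literature.NumberTheory.DiophantineGeometry.IsABCTriple t.1 t.2.1 t.2.2 ∧ t.2.2 ≤ N ∧ Literature.NumberTheory.DiophantineGeometry.rad t.1 t.2.1 t.2.2 ≤ t.2.2} : ℝ) ≤ C * (N : ℝ) ^ ε := by
  sorry

end Stub

/-! ## The sufficient route, kernel-checked from the landed files -/

/-- `LevelTorsorBound ⟹ ShapeLevelBound` (landed `Summit.ABC.ABC.Theorems.ShapeLevelLift`, p73647). -/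
theorem shapeLevelBound_of_levelTorsorBound (h : LevelTorsorBound) : ShapeLevelBound :=
  Summit.ABC.ABC.Theorems.ShapeLevelLift h

/-- `LevelTorsorBound ⟹ LeverSliceBound` (landed chain `ShapeLevelLift`, `SliceClassBound`, `SliceReduction`, composed in
`Summit.ABC.ABC.Theorems.MazurKaneLaw.leverSliceBound_of_levelTorsorBound`). -/
theorem leverSliceBound_of_levelTorsorBound (h : LevelTorsorBound) : LeverSliceBound :=
  Summit.ABC.ABC.Theorems.MazurKaneLaw.leverSliceBound_of_levelTorsorBound h

/-- **The lever suffices for the first stub**: `LevelTorsorBound ⟹ SliceLawHigh`. -/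
theorem sliceLawHigh_of_levelTorsorBound (h : LevelTorsorBound) : SliceLawHigh :=
  Summit.ABC.ABC.Theorems.MazurKaneLaw.sliceLawHigh_of_levelTorsorBound h

/-- **The reach of the lever alone**: `LevelTorsorBound ⟹` the Mazur–Kane law for every `s ∈ [13/7, 2)` (landed
`Summit.ABC.ABC.Theorems.LeverReach`). -/
theorem lawAt_high_of_levelTorsorBound (h : LevelTorsorBound) :
    ∀ s : ℝ, 13 / 7 ≤ s → s < 2 → ∀ ε : ℝ, 0 < ε → ∃ C : ℝ, ∀ N : ℕ, 2 ≤ N →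
      (Set.ncard {t : ℕ × ℕ × ℕ | IsABCTriple t.1 t.2.1 t.2.2 ∧ t.2.2 ≤ N ∧
        ((rad t.1 t.2.1 t.2.2 : ℕ) : ℝ) ≤ (t.2.2 : ℝ) ^ s} : ℝ) ≤ C * (N : ℝ) ^ (s - 1 + ε) :=
  Summit.ABC.ABC.Theorems.LeverReach h

/-- **The price of the lever as stated**: `LevelTorsorBound ⟹` the Pell box bound
`#{(d,u,t) ∈ [D,2D)×[U,2U)×[T,2T) : t² = du² + 1} ≤ K (T²)^ε (1 + DUT/T²)` (landed `Summit.ABC.ABC.Theorems.LeverPellBox`),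
which for `T ≍ U√D` is the upper-bound half of Hooley's conjecture for every `α`. -/
theorem pellBox_of_levelTorsorBound (h : LevelTorsorBound) :
    ∀ ε : ℝ, 0 < ε → ∃ K : ℝ, ∀ D U T : ℕ, 0 < D → 0 < U → 0 < T →
      ((((Finset.Ico D (2 * D) ×ˢ Finset.Ico U (2 * U) ×ˢ Finset.Ico T (2 * T)).filter
          (fun p => p.2.2 ^ 2 = p.1 * p.2.1 ^ 2 + 1)).card : ℕ) : ℝ) ≤
        K * ((T : ℝ) ^ 2) ^ ε * (1 + (D : ℝ) * U * T / (T : ℝ) ^ 2) :=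
  Summit.ABC.ABC.Theorems.LeverPellBox h

/-! ## The recommended lever statement for `SliceLawHigh`: the torsor bound RESTRICTED to high-slice classes -/

/-- **ShapeLevelBoundOnHighSlices** (documentation `Prop`, NOT registered; the lead's recommended LEVER for `SliceLawHigh`):
the shape-level torsor bound `shapeCount ≤ K (c₃ shapeVal Z)^ε (∏_{i≥2} XᵢYᵢZᵢ + ∏ XᵢYᵢZᵢ/(c₃ shapeVal Z))` asked ONLY on class data
that are admissible for exponent `s + ε` with `s ∈ [5/3, 2)` AND carry the radical lower bound of the slice `c^{s-η} < rad(abc)`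
(`C₀^{s-η} ≤ (2C₀)^{3ε/2} 8^M ∏ XᵢYᵢZᵢ`, window `η ≤ 1/12` so that `s - η ≥ 19/12 > 3/2`), with `K` allowed to depend on `(s, ε, η)`.
This is exactly what the landed chain consumes (`SliceClassBoundHigh` = adaptation of `SliceClassBound`; then the landed
`SliceReduction`), it is implied by `LevelTorsorBound` (`shapeLevelBoundOnHighSlices_of_levelTorsorBound`, trivial specialisation),
and it EXCLUDES the Pell corner of `LeverPellBox`: the Pell classes `(du², 1, t²)` have `∏P = D^{3/2}U² = C₀^{3/2}/U`, incompatible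
with the lower bound at `s - η ≥ 19/12` except for boundedly many `C₀` (absorbed in `K`). Whether OTHER norm-form corners survive the
restriction is for the refuters; on the wall family it is the same full-saving statement as before.
`sliceLawHigh_of_shapeLevelBoundOnHighSlices` (below; = Theorems `HighSliceLever`): `ShapeLevelBoundOnHighSlices ⟹ SliceLawHigh`. -/
def ShapeLevelBoundOnHighSlices : Prop :=
  ∀ s : ℝ, 5 / 3 ≤ s → s < 2 → ∀ ε : ℝ, 0 < ε → ε ≤ 1 / 4 → ∀ η : ℝ, 0 < η → η ≤ 1 / 12 → ∃ K : ℝ,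
    ∀ (C₀ c₁ c₂ c₃ : ℕ) (X Y Z : Fin (numShapes ε) → ℕ),
      Admissible (s + ε) ε C₀ c₁ c₂ c₃ X Y Z →
        ((C₀ : ℝ) ^ (s - η) ≤ (2 * (C₀ : ℝ)) ^ (3 * ε / 2) * (8 : ℝ) ^ (numShapes ε) * ∏ i, ((X i : ℝ) * Y i * Z i)) →
          (shapeCount c₁ c₂ c₃ X Y Z : ℝ) ≤ K * ((c₃ : ℝ) * ((shapeVal Z : ℕ) : ℝ)) ^ ε *
            ((∏ i ∈ Finset.univ.filter (fun i : Fin (numShapes ε) => 2 ≤ (i : ℕ)), ((X i : ℝ) * Y i * Z i)) +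
              (∏ i, ((X i : ℝ) * Y i * Z i)) / ((c₃ : ℝ) * ((shapeVal Z : ℕ) : ℝ)))

/-- The unrestricted lever implies the restricted one (specialise `ShapeLevelBound` at `d = numShapes ε ≥ 6`). -/
theorem shapeLevelBoundOnHighSlices_of_levelTorsorBound (h : LevelTorsorBound) : ShapeLevelBoundOnHighSlices := by
  intro s _ _ ε hε hε4 η _ _
  have h6 : 6 ≤ numShapes ε := six_le_numShapes hε hε4
  obtain ⟨K, hK⟩ := shapeLevelBound_of_levelTorsorBound h ε hε (numShapes ε) (by omega)
  exact ⟨K, fun C₀ c₁ c₂ c₃ X Y Z hA _ => hK c₁ c₂ c₃ X Y Z hA.pos₁ hA.pos₂ hA.pos₃ hA.X_pos hA.Y_pos hA.Z_pos⟩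

/-- **Restricted lever ⟹ the first stub**: `ShapeLevelBoundOnHighSlices ⟹ SliceLawHigh` (same proof as the Theorems file
`TwistAmplificationMazurKaneLawHighSliceLever`, `HighSliceLever`: landed `SliceClassBoundHigh` + landed `SliceReduction` +
`card_classRange_le`; shape parameter `ε₁ = min(ε/20, 1/4)`, window `η = min(ε/4, 1/12)`, class slack `ε/4`). -/
theorem sliceLawHigh_of_shapeLevelBoundOnHighSlices (hLever : ShapeLevelBoundOnHighSlices) : SliceLawHigh := by
  intro ε hε
  obtain ⟨ε₁, hε₁⟩ : ∃ t : ℝ, t = min (ε / 20) (1 / 4) := ⟨_, rfl⟩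
  obtain ⟨η, hη⟩ : ∃ t : ℝ, t = min (ε / 4) (1 / 12) := ⟨_, rfl⟩
  have hε₁0 : 0 < ε₁ := by rw [hε₁]; exact lt_min (by positivity) (by norm_num)
  have hε₁4 : ε₁ ≤ 1 / 4 := by rw [hε₁]; exact min_le_right _ _
  have hε₁ε : ε₁ ≤ ε / 20 := by rw [hε₁]; exact min_le_left _ _
  have hη0 : 0 < η := by rw [hη]; exact lt_min (by positivity) (by norm_num)
  have hηε : η ≤ ε / 4 := by rw [hη]; exact min_le_left _ _
  have hη12 : η ≤ 1 / 12 := by rw [hη]; exact min_le_right _ _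
  refine ⟨η, hη0, fun s hs53 hs2 => ?_⟩
  obtain ⟨K, hK0, hK⟩ := Summit.ABC.ABC.Theorems.SliceClassBoundHigh hLever s hs53 hs2 ε₁ hε₁0 hε₁4 η hη0 hη12
  have hθ0 : 0 ≤ s - 1 + 5 * ε₁ + η := by linarith
  have hred := Summit.ABC.ABC.Theorems.SliceReduction s (by linarith) hs2 ε₁ hε₁0 hε₁4 η hη0 (by linarith) _ K
    hθ0 hK0 hK
  obtain ⟨C, hC0, hC⟩ := card_classRange_le ε₁ (δ := ε / 4) (by positivity)
  refine ⟨K * C, fun N hN => ?_⟩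
  have hN1 : (1 : ℝ) ≤ N := by exact_mod_cast (by omega : 1 ≤ N)
  have hN0 : (0 : ℝ) < N := by positivity
  have hexp : (N : ℝ) ^ (3 * ε₁ / 2 + ε / 4) * (N : ℝ) ^ (s - 1 + 5 * ε₁ + η) ≤ (N : ℝ) ^ (s - 1 + ε) := by
    rw [← Real.rpow_add hN0]
    exact Real.rpow_le_rpow_of_exponent_le hN1 (by linarith)
  calc (Set.ncard {t : ℕ × ℕ × ℕ | IsABCTriple t.1 t.2.1 t.2.2 ∧ t.2.2 ≤ N ∧
          (t.2.2 : ℝ) ^ (s - η) < ((rad t.1 t.2.1 t.2.2 : ℕ) : ℝ) ∧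
          ((rad t.1 t.2.1 t.2.2 : ℕ) : ℝ) ≤ (t.2.2 : ℝ) ^ s} : ℝ)
        ≤ K * (classRange ε₁ N).card * (N : ℝ) ^ (s - 1 + 5 * ε₁ + η) := hred N
    _ ≤ K * (C * (N : ℝ) ^ (3 * ε₁ / 2 + ε / 4)) * (N : ℝ) ^ (s - 1 + 5 * ε₁ + η) :=
        mul_le_mul_of_nonneg_right (mul_le_mul_of_nonneg_left (hC N hN) hK0) (by positivity)
    _ = K * C * ((N : ℝ) ^ (3 * ε₁ / 2 + ε / 4) * (N : ℝ) ^ (s - 1 + 5 * ε₁ + η)) := by ring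
    _ ≤ K * C * (N : ℝ) ^ (s - 1 + ε) := mul_le_mul_of_nonneg_left hexp (mul_nonneg hK0 hC0.le)

/-! ## The composition (kernel-checked; concludes the crux BY NAME) -/

/-- **`MazurKaneLaw_of`** — the range split: the three registered stubs (slice law on `[5/3,2)`, slice law on `(1,5/3)`, hit
bound) give the crux (landed glue `Summit.ABC.ABC.Theorems.SliceAssembly`, p74525). -/
theorem MazurKaneLaw_of (hHigh : SliceLawHigh) (hLow : SliceLawLow) (hHit : HitBound) :
    Summit.ABC.ABC.Theses.TwistAmplification.MazurKaneLaw :=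
  Summit.ABC.ABC.Theorems.SliceAssembly hHigh hLow hHit

/-- The crux from the LEVER and the two foreign ranges (v2's composition, now a corollary). -/
theorem MazurKaneLaw_of_lever (hLever : LevelTorsorBound) (hLow : SliceLawLow) (hHit : HitBound) :
    Summit.ABC.ABC.Theses.TwistAmplification.MazurKaneLaw :=
  MazurKaneLaw_of (sliceLawHigh_of_levelTorsorBound hLever) hLow hHit

/-- **The skeleton**: the crux modulo exactly the three registered stubs `Stub.SliceLawHigh`, `Stub.SliceLawLow`,
`Stub.HitBound`. -/
theorem MazurKaneLaw_proof : Summit.ABC.ABC.Theses.TwistAmplification.MazurKaneLaw :=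
  MazurKaneLaw_of Stub.SliceLawHigh Stub.SliceLawLow Stub.HitBound

end Summit.ABC.ABC.Cruxes.MazurKaneLaw.PeyreLevelTorsorV22
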